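import Mathlib

/-!
# STUB-IDEAS `stub_heegnerIndexLowerAtTwo` — k = 1, gen 29 (technique «weaken / strengthen»)

## TORSION CENSUS ⟹ MODULE CLASS, and VALUE ⟹ DIGIT — the two conversions R201 / R196‴ need, typed

Crux `stmt-BirchSwinnertonDyer-27851` = `PrintCf2.SplitBadTwoLowerHalfOfFacts`; stub of record
`stub_heegnerIndexLowerAtTwo` (skeleton v3 `heegner_index_two`, sha16 `f2bd84c029a8a938`).
BSD is NOT proved by anything here; neither the crux nor the stub's LOWER inequality is proved.
Everything below is ABSTRACT commutative / group algebra, sorry-free, `import Mathlib` only; the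
instantiation (`Λ := IwasawaAlgebra 2 = ℤ₂⟦X⟧`, `𝔟 :=` the module class of `M(key)_v` from the tree's
`IwasawaAlgebra.exists_linearEquiv_ideal_finite_quotient`, `a := X` or `ω_n = (1+X)^{2^n} - 1`,
`A := Additive (L_nˣ)`, `φ := ev_ρ`) is the typer's (R197a′), exactly as for k1-g28 §E.

* §D  index calculus: `|(𝔟 ∩ aΛ)/a𝔟| = |Λ/(𝔟 + aΛ)|` (no snake lemma: two applications of
      `relIndex_mul_index` + `index_comap` + `relIndex_map_map_of_injective`); for `a ∈ 𝔟` the count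
      is `|Λ/𝔟|`; count `1` ⟺ free, count `2` (with residue field `𝔽₂`) ⟺ `𝔟 = 𝔪`.
      READING: `(𝔟 ∩ ω_nΛ)/ω_n𝔟 = ker(𝔟/ω_n𝔟 → Λ/ω_nΛ)` = the `ℤ₂`-torsion of the layer-`n`
      coinvariants `M_{Γ_n} ≅ Q_n(u)` (K3), because `Λ/ω_nΛ = ℤ₂[Γ/Γ_n]` is torsion-free and the
      kernel is finite.  Hence  `|tors Q_n(u)| = |Λ/(𝔟 + ω_nΛ)| ↑ |Λ/𝔟|`:  the TORSION CENSUS of the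
      norm-one torus quotients computes the EXACT module class (R196‴-narrowed) — `2` for ever ⟹ `𝔪_v`,
      `1` for ever ⟹ free — and its layer-0 entry alone gives NON-FREENESS (R201, conductor 4).
* §T  the census itself, abstractly (g28's additive model of `L_nˣ`): `-1 ∈ (1-σ)U¹(L_n) ⟺ v_L(√u)` even
      (conductor 4: yes; conductor 8: no), and `p - σp ∉ (1-σ)U` for `v p` odd (= k1-g28
      `seamGen_not_mem`: `±i ∉ D_n`).  So `tors₂ D_n = {±1}` resp. `{1}` at EVERY layer.
* §C  value ⟹ digit: for `𝔟 ≠ ⊤` (non-free) and a local `φ` with `2 ∣ φ(𝔪_Λ)`: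
      (α) `φ(r·x) = 4·unit`, `x ∈ 𝔟` ⟹ `φ r ∣ 2` (upper bound on the digit AT THE SAME CHARACTER, no floor);
      (β) + floor `r = 2s` ⟹ `s` is a unit ⟹ `ψ r = 2·unit` at EVERY character `ψ` (unit reflection);
      (γ) the same value datum on the FREE class forces `s` NON-unit (critic's K35 counter-model, typed).
* §K  the shapes of K3 the two consumers need: K3_LOWER = a surjection onto a non-cyclic `Q_0(u)`;
      K3_EXACT = `M_{Γ_n} ≃ Q_n(u)` from (norm onto) + (ker N = (γ-1)) at each unramified layer.
-/

set_option linter.dupNamespace false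

namespace Summit.BirchSwinnertonDyer.BirchSwinnertonDyer.Cruxes.SplitBadTwoLowerHalfOfFacts.TorsionCensusK1G29

/-! ## §D  Index calculus on an ideal `𝔟 ⊂ Λ` and a regular element `a` -/
section IndexCalculus

variable {Λ : Type*} [CommRing Λ]

/-- `(𝔟 : a) = {x | a·x ∈ 𝔟}` as an additive subgroup of `Λ`. -/
def colon (B : Ideal Λ) (a : Λ) : AddSubgroup Λ :=
  B.toAddSubgroup.comap (AddMonoidHom.mulLeft a)

/-- `a·𝔟` as an additive subgroup of `Λ`. -/
def smulIdeal (B : Ideal Λ) (a : Λ) : AddSubgroup Λ :=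
  B.toAddSubgroup.map (AddMonoidHom.mulLeft a)

theorem mem_colon {B : Ideal Λ} {a x : Λ} : x ∈ colon B a ↔ a * x ∈ B := Iff.rfl

theorem mem_smulIdeal {B : Ideal Λ} {a x : Λ} : x ∈ smulIdeal B a ↔ ∃ b ∈ B, a * b = x := by
  simp only [smulIdeal, AddSubgroup.mem_map, Submodule.mem_toAddSubgroup, AddMonoidHom.coe_mulLeft]

theorem le_colon (B : Ideal Λ) (a : Λ) : B.toAddSubgroup ≤ colon B a :=
  fun _ hx => B.mul_mem_left a hx

theorem smulIdeal_le (B : Ideal Λ) (a : Λ) :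
    smulIdeal B a ≤ B.toAddSubgroup ⊓ (Ideal.span {a}).toAddSubgroup := by
  rintro x hx
  obtain ⟨b, hb, rfl⟩ := mem_smulIdeal.1 hx
  exact ⟨B.mul_mem_left a hb, Ideal.mem_span_singleton'.2 ⟨b, mul_comm b a⟩⟩

theorem range_mulLeft (a : Λ) :
    (AddMonoidHom.mulLeft a).range = (Ideal.span {a}).toAddSubgroup := by
  ext x
  simp only [AddMonoidHom.mem_range, AddMonoidHom.coe_mulLeft, Submodule.mem_toAddSubgroup,
    Ideal.mem_span_singleton']
  constructor
  · rintro ⟨y, rfl⟩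
    exact ⟨y, mul_comm y a⟩
  · rintro ⟨y, rfl⟩
    exact ⟨y, mul_comm a y⟩

theorem map_colon (B : Ideal Λ) (a : Λ) :
    (colon B a).map (AddMonoidHom.mulLeft a) =
      B.toAddSubgroup ⊓ (Ideal.span {a}).toAddSubgroup := by
  ext x
  simp only [AddSubgroup.mem_map, mem_colon, AddMonoidHom.coe_mulLeft, AddSubgroup.mem_inf,
    Submodule.mem_toAddSubgroup, Ideal.mem_span_singleton']
  constructor
  · rintro ⟨y, hy, rfl⟩
    exact ⟨hy, y, mul_comm y a⟩
  · rintro ⟨hx, y, rfl⟩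
    exact ⟨y, by simpa [mul_comm] using hx, mul_comm a y⟩

/-- `|Λ/(𝔟 : a)| = |aΛ/(𝔟 ∩ aΛ)|` (multiplication by `a` induces `Λ/(𝔟:a) ↪ Λ/𝔟` with image `(aΛ+𝔟)/𝔟`). -/
theorem index_colon (B : Ideal Λ) (a : Λ) :
    (colon B a).index = B.toAddSubgroup.relIndex (Ideal.span {a}).toAddSubgroup := by
  rw [colon, AddSubgroup.index_comap, range_mulLeft]

/-- **Kernel count = cokernel count.** `|(𝔟 : a)/𝔟| = |Λ/(𝔟 + aΛ)|` whenever `Λ/𝔟` is finite: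
both sides are `|Λ/𝔟| / |(aΛ + 𝔟)/𝔟|` (`(𝔟:a)/𝔟 = (Λ/𝔟)[a]`, `Λ/(𝔟+aΛ) = (Λ/𝔟)/a(Λ/𝔟)`, and an
endomorphism of a finite group has `|ker| = |coker|`).  No snake lemma is used. -/
theorem relIndex_colon_eq (B : Ideal Λ) (a : Λ) (hB : B.toAddSubgroup.index ≠ 0) :
    B.toAddSubgroup.relIndex (colon B a) =
      (B.toAddSubgroup ⊔ (Ideal.span {a}).toAddSubgroup).index := by
  have h1 := AddSubgroup.relIndex_mul_index (le_colon B a)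
  have h2 := AddSubgroup.relIndex_mul_index
    (le_sup_left : B.toAddSubgroup ≤ B.toAddSubgroup ⊔ (Ideal.span {a}).toAddSubgroup)
  rw [index_colon] at h1
  rw [AddSubgroup.relIndex_sup_left] at h2
  have hne : B.toAddSubgroup.relIndex (Ideal.span {a}).toAddSubgroup ≠ 0 := by
    intro h0
    rw [h0, mul_zero] at h1
    exact hB h1.symm
  have key : B.toAddSubgroup.relIndex (Ideal.span {a}).toAddSubgroup *
      B.toAddSubgroup.relIndex (colon B a) =
      B.toAddSubgroup.relIndex (Ideal.span {a}).toAddSubgroup *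
        (B.toAddSubgroup ⊔ (Ideal.span {a}).toAddSubgroup).index := by
    rw [mul_comm, h1, h2]
  exact Nat.eq_of_mul_eq_mul_left (Nat.pos_of_ne_zero hne) key

/-- Transport along the injective map `x ↦ a·x`: `|(𝔟 ∩ aΛ)/a𝔟| = |(𝔟 : a)/𝔟|`. -/
theorem relIndex_smulIdeal_inf (B : Ideal Λ) {a : Λ} (ha : IsLeftRegular a) :
    (smulIdeal B a).relIndex (B.toAddSubgroup ⊓ (Ideal.span {a}).toAddSubgroup) =
      B.toAddSubgroup.relIndex (colon B a) := by
  rw [smulIdeal, ← map_colon]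
  exact AddSubgroup.relIndex_map_map_of_injective _ _ (fun x y h => ha h)

/-- **TORSION COUNT.** `|(𝔟 ∩ aΛ)/a𝔟| = |Λ/(𝔟 + aΛ)|` for `a` regular and `Λ/𝔟` finite.
READING (typer): with `a = ω_n`, the left side is `|tors_{ℤ₂}(𝔟/ω_n𝔟)| = |tors Q_n(u)|` (K3). -/
theorem torsionCount (B : Ideal Λ) {a : Λ} (ha : IsLeftRegular a) (hB : B.toAddSubgroup.index ≠ 0) :
    (smulIdeal B a).relIndex (B.toAddSubgroup ⊓ (Ideal.span {a}).toAddSubgroup) =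
      (B.toAddSubgroup ⊔ (Ideal.span {a}).toAddSubgroup).index := by
  rw [relIndex_smulIdeal_inf B ha, relIndex_colon_eq B a hB]

/-- Stabilisation: once `a ∈ 𝔟` (for `a = ω_n` and `n ≥ n₀(𝔟)`, since `𝔟 ⊇ 𝔪^k ∋ ω_n`), the torsion
count IS the colength `|Λ/𝔟|`. -/
theorem torsionCount_of_mem (B : Ideal Λ) {a : Λ} (ha : IsLeftRegular a)
    (hB : B.toAddSubgroup.index ≠ 0) (haB : a ∈ B) :
    (smulIdeal B a).relIndex (B.toAddSubgroup ⊓ (Ideal.span {a}).toAddSubgroup) =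
      B.toAddSubgroup.index := by
  rw [torsionCount B ha hB]
  congr 1
  refine le_antisymm (sup_le le_rfl ?_) le_sup_left
  intro x hx
  rw [Submodule.mem_toAddSubgroup, Ideal.mem_span_singleton'] at hx
  obtain ⟨c, rfl⟩ := hx
  exact B.mul_mem_left c haB

/-- The FREE class has torsion-free coinvariants at every layer: count `1`. -/
theorem torsionCount_top {a : Λ} (ha : IsLeftRegular a) :
    (smulIdeal (⊤ : Ideal Λ) a).relIndex
      ((⊤ : Ideal Λ).toAddSubgroup ⊓ (Ideal.span {a}).toAddSubgroup) = 1 := by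
  have htop : (⊤ : Ideal Λ).toAddSubgroup = ⊤ := by
    ext x
    simp
  rw [torsionCount ⊤ ha (by rw [htop, AddSubgroup.index_top]; exact one_ne_zero), htop, top_sup_eq,
    AddSubgroup.index_top]

/-- **Non-freeness test (R201, conductor 4; the weakest form of K3 feeds it):** ONE layer with a
non-trivial torsion count already forces `𝔟 ≠ ⊤`. -/
theorem ne_top_of_torsionCount_ne_one (B : Ideal Λ) {a : Λ} (ha : IsLeftRegular a)
    (h : (smulIdeal B a).relIndex (B.toAddSubgroup ⊓ (Ideal.span {a}).toAddSubgroup) ≠ 1) :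
    B ≠ ⊤ := by
  rintro rfl
  exact h (torsionCount_top ha)

theorem eq_top_of_index_eq_one (B : Ideal Λ) (h : B.toAddSubgroup.index = 1) : B = ⊤ := by
  rw [AddSubgroup.index_eq_one] at h
  refine eq_top_iff.mpr fun x _ => ?_
  rw [← Submodule.mem_toAddSubgroup, h]
  trivial

/-- In a local ring, an ideal with the same (finite, `≠ 1`) index as `𝔪` IS `𝔪`. -/
theorem eq_maximalIdeal_of_index_eq [IsLocalRing Λ] (B : Ideal Λ)
    (h𝔪 : (IsLocalRing.maximalIdeal Λ).toAddSubgroup.index = B.toAddSubgroup.index)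
    (hB1 : B.toAddSubgroup.index ≠ 1) (hB0 : B.toAddSubgroup.index ≠ 0) :
    B = IsLocalRing.maximalIdeal Λ := by
  have hne : B ≠ ⊤ := by
    intro h
    apply hB1
    rw [h]
    have htop : (⊤ : Ideal Λ).toAddSubgroup = ⊤ := by
      ext x
      simp
    rw [htop, AddSubgroup.index_top]
  have hle : B ≤ IsLocalRing.maximalIdeal Λ := IsLocalRing.le_maximalIdeal hne
  have hle' : B.toAddSubgroup ≤ (IsLocalRing.maximalIdeal Λ).toAddSubgroup := fun x hx => hle hx
  have hmul := AddSubgroup.relIndex_mul_index hle'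
  rw [h𝔪] at hmul
  have h1 : B.toAddSubgroup.relIndex (IsLocalRing.maximalIdeal Λ).toAddSubgroup = 1 :=
    Nat.eq_of_mul_eq_mul_right (Nat.pos_of_ne_zero hB0) (hmul.trans (one_mul _).symm)
  rw [AddSubgroup.relIndex_eq_one] at h1
  exact le_antisymm hle (fun x hx => h1 hx)

/-- **R196‴-narrowed by census (conductor 4):** residue field `𝔽₂` (`|Λ/𝔪| = 2`) and an eventual
torsion count `2` force `𝔟 = 𝔪`. -/
theorem eq_maximalIdeal_of_torsionCount [IsLocalRing Λ] (B : Ideal Λ) {a : Λ} (ha : IsLeftRegular a)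
    (haB : a ∈ B) (hB0 : B.toAddSubgroup.index ≠ 0)
    (h𝔪2 : (IsLocalRing.maximalIdeal Λ).toAddSubgroup.index = 2)
    (hcount : (smulIdeal B a).relIndex (B.toAddSubgroup ⊓ (Ideal.span {a}).toAddSubgroup) = 2) :
    B = IsLocalRing.maximalIdeal Λ := by
  rw [torsionCount_of_mem B ha hB0 haB] at hcount
  exact eq_maximalIdeal_of_index_eq B (h𝔪2.trans hcount.symm) (by rw [hcount]; decide) hB0

/-- **Free half by census (conductor 8):** an eventual torsion count `1` forces `𝔟 = Λ`. -/
theorem eq_top_of_torsionCount (B : Ideal Λ) {a : Λ} (ha : IsLeftRegular a) (haB : a ∈ B)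
    (hB0 : B.toAddSubgroup.index ≠ 0)
    (hcount : (smulIdeal B a).relIndex (B.toAddSubgroup ⊓ (Ideal.span {a}).toAddSubgroup) = 1) :
    B = ⊤ := by
  rw [torsionCount_of_mem B ha hB0 haB] at hcount
  exact eq_top_of_index_eq_one B hcount

/-- **READING LEMMA (torsion = kernel).**  If `Λ/aΛ` has no `ℤ`-torsion (`a = ω_n`:
`Λ/ω_nΛ = ℤ₂[Γ/Γ_n]`) and the count is finite, an element `x ∈ 𝔟` is `ℤ`-TORSION modulo `a𝔟` iff
`x ∈ aΛ`.  Hence `tors_ℤ(𝔟/a𝔟) = (𝔟 ∩ aΛ)/a𝔟` and `|tors_ℤ(𝔟/a𝔟)|` is exactly `torsionCount`. -/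
theorem isTorsionMod_iff (B : Ideal Λ) (a : Λ)
    (htf : ∀ n : ℕ, n ≠ 0 → ∀ y : Λ, (n : Λ) * y ∈ Ideal.span {a} → y ∈ Ideal.span {a})
    (hfin : (smulIdeal B a).relIndex (B.toAddSubgroup ⊓ (Ideal.span {a}).toAddSubgroup) ≠ 0)
    {x : Λ} (hx : x ∈ B) :
    (∃ n : ℕ, n ≠ 0 ∧ n • x ∈ smulIdeal B a) ↔ x ∈ Ideal.span {a} := by
  constructor
  · rintro ⟨n, hn, hnx⟩
    refine htf n hn x ?_
    have h := (smulIdeal_le B a hnx).2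
    simpa [nsmul_eq_mul] using h
  · intro hxa
    exact ⟨_, hfin, AddSubgroup.nsmul_relIndex_mem (smulIdeal B a)
      (K := B.toAddSubgroup ⊓ (Ideal.span {a}).toAddSubgroup) ⟨hx, hxa⟩⟩

/-- **TWIST INVARIANCE of the census/class.**  A ring automorphism `e` (the typer's twisting
automorphism `γ ↦ ρ(γ)γ` of `Λ`) preserves the colength of the module class: `|Λ/e(𝔟)| = |Λ/𝔟|`;
with `eq_maximalIdeal_of_index_eq` the class `𝔪` (colength 2) is therefore twist-stable. -/
theorem index_map_ringEquiv (B : Ideal Λ) (e : Λ ≃+* Λ) :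
    (B.toAddSubgroup.map (e.toAddEquiv : Λ →+ Λ)).index = B.toAddSubgroup.index :=
  AddSubgroup.index_map_equiv B.toAddSubgroup e.toAddEquiv

end IndexCalculus

/-! ## §T  The census: roots of unity in the norm-one torus `(1-σ)U¹(L_n)` (additive model of `L_nˣ`) -/
section Census

variable {A : Type*} [AddCommGroup A] (σ : A →+ A) (v : A →+ ℤ)

/-- `D = (1-σ)(ker v)`: the quotients `x/σx` of UNITS, written additively (`= Im Q_n ≅ Q_n(u)`). -/
def normQuot : AddSubgroup A := (v.ker).map (AddMonoidHom.id A - σ)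

theorem mem_normQuot {x : A} : x ∈ normQuot σ v ↔ ∃ y, v y = 0 ∧ y - σ y = x := by
  simp only [normQuot, AddSubgroup.mem_map, AddMonoidHom.mem_ker, AddMonoidHom.sub_apply,
    AddMonoidHom.id_apply]

/-- **`-1 ∈ (1-σ)U¹(L_n) ⟺ v_L(√u)` is even.**  Dictionary: `m := -1` (so `m + m = 0`), `s := √u`
(so `σ s = s + m`, i.e. `σ√u = -√u`), `hF` : `σ`-fixed elements (= `F_nˣ`) have even valuation
(`e(L_n/F_n) = 2`), `f₀` = a uniformiser of `F_n` (`σ f₀ = f₀`, `v f₀ = 2`).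
Conductor 4 (`u ∈ {-1, 3}`, `√u` a unit): `-1 ∈ D_n`; conductor 8 (`u ∈ {±2, ±6}`, `v(√u) = 1`): `-1 ∉ D_n`.
(Global analogue: the Hasse unit index of a CM field.) -/
theorem neg_one_mem_normQuot_iff {m s f₀ : A} (hs : σ s = s + m)
    (hF : ∀ a, σ a = a → (2 : ℤ) ∣ v a) (hf₀ : σ f₀ = f₀) (hvf₀ : v f₀ = 2) (hm2 : m + m = 0) :
    m ∈ normQuot σ v ↔ (2 : ℤ) ∣ v s := by
  constructor
  · intro h
    obtain ⟨y, hy0, hy⟩ := (mem_normQuot σ v).1 h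
    have hσy : σ y = y - m := by
      rw [← hy]
      abel
    have hfix : σ (y - s) = y - s := by
      rw [map_sub, hσy, hs]
      have : y - m - (s + m) = y - s - (m + m) := by abel
      rw [this, hm2, sub_zero]
    have h2 := hF _ hfix
    rw [map_sub, hy0, zero_sub, dvd_neg] at h2
    exact h2
  · rintro ⟨k, hk⟩
    refine (mem_normQuot σ v).2 ⟨s - k • f₀, ?_, ?_⟩
    · rw [map_sub, map_zsmul, hvf₀, hk, smul_eq_mul]
      ring
    · rw [map_sub, map_zsmul, hf₀, hs]
      have : s - k • f₀ - (s + m - k • f₀) = -m := by abel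
      rw [this]
      exact neg_eq_of_add_eq_zero_right hm2

/-- (= k1-g28 `SeamWitnessK1G28.seamGen_not_mem`, restated in this notation; NOT claimed new.)
`p - σ p ∉ (1-σ)U` when `v p` is odd: with `p = 1 + i` (a uniformiser of `L_n` whenever `i ∈ L_n`,
since `L_n/ℚ₂(i)` is unramified) this is `±i ∉ D_n`. -/
theorem sub_map_not_mem_normQuot {p : A} (hp : ¬ (2 : ℤ) ∣ v p)
    (hF : ∀ a, σ a = a → (2 : ℤ) ∣ v a) : p - σ p ∉ normQuot σ v := by
  intro h
  obtain ⟨y, hy0, hy⟩ := (mem_normQuot σ v).1 h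
  have hσy : σ y = y - (p - σ p) := by
    rw [← hy]
    abel
  have hfix : σ (y - p) = y - p := by
    rw [map_sub, hσy]
    abel
  have h2 := hF _ hfix
  rw [map_sub, hy0, zero_sub, dvd_neg] at h2
  exact hp h2

/-- **Census, 2-torsion part:** if `μ₂(L_n) = {±1}` (`t + t = 0 → t = 0 ∨ t = m`), the elements of order
`≤ 2` in `D_n` are `{0}` or `{0, m}` according to the parity of `v(√u)`. -/
theorem two_torsion_normQuot {m s f₀ : A} (hs : σ s = s + m)
    (hF : ∀ a, σ a = a → (2 : ℤ) ∣ v a) (hf₀ : σ f₀ = f₀) (hvf₀ : v f₀ = 2) (hm2 : m + m = 0)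
    (hμ : ∀ t : A, t + t = 0 → t = 0 ∨ t = m) {t : A} (ht : t ∈ normQuot σ v) (htt : t + t = 0) :
    t = 0 ∨ (t = m ∧ (2 : ℤ) ∣ v s) := by
  rcases hμ t htt with rfl | rfl
  · exact Or.inl rfl
  · exact Or.inr ⟨rfl, (neg_one_mem_normQuot_iff σ v hs hF hf₀ hvf₀ hm2).1 ht⟩

end Census

/-! ## §C  Value ⟹ digit: exactly the module-class bit converts a layer value into `r_u ∈ 2Λ_vˣ` -/
section Digit

variable {Λ O : Type*} [CommRing Λ] [IsLocalRing Λ] [CommRing O]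

/-- Discharge of `2 ∣ φ(𝔪_Λ)`: `𝔪_Λ = (2, a)` (`a = X = γ - 1`) and `2 ∣ φ a` (`ρ(γ) ≡ 1 (mod 2)`, true for
every `ℤ₂ˣ`-valued character). -/
theorem two_dvd_map_of_mem_maximalIdeal (φ : Λ →+* O) {a : Λ}
    (hgen : IsLocalRing.maximalIdeal Λ = Ideal.span {2, a}) (ha : (2 : O) ∣ φ a) :
    ∀ x ∈ IsLocalRing.maximalIdeal Λ, (2 : O) ∣ φ x := by
  intro x hx
  rw [hgen, Ideal.mem_span_pair] at hx
  obtain ⟨c, d, rfl⟩ := hx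
  simp only [map_add, map_mul, map_ofNat]
  exact dvd_add (dvd_mul_left _ _) (dvd_mul_of_dvd_right ha _)

/-- **(α) LOWER's weakest sufficient form — no floor.** Non-free class (`𝔟 ≠ ⊤`), a witness `x ∈ 𝔟`
whose value at `φ` is `4·unit`: then `φ r ∣ 2`, i.e. `v(ev_φ r_u) ≤ v(2)` AT THE SAME CHARACTER `φ`. -/
theorem map_dvd_two_of_value (φ : Λ →+* O)
    (h𝔪 : ∀ x ∈ IsLocalRing.maximalIdeal Λ, (2 : O) ∣ φ x) (h2 : IsLeftRegular (2 : O))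
    {B : Ideal Λ} (hB : B ≠ ⊤) {r x : Λ} (hx : x ∈ B) {w : O} (hw : IsUnit w)
    (hval : φ (r * x) = 4 * w) : φ r ∣ 2 := by
  obtain ⟨y, hy⟩ := h𝔪 x (IsLocalRing.le_maximalIdeal hB hx)
  have h : (2 : O) * (φ r * y) = 2 * (2 * w) := by
    calc (2 : O) * (φ r * y) = φ r * (2 * y) := by ring
      _ = φ r * φ x := by rw [hy]
      _ = φ (r * x) := by rw [map_mul]
      _ = 4 * w := hval
      _ = 2 * (2 * w) := by ring
  have h' : φ r * y = 2 * w := h2 h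
  have hdvd : φ r ∣ 2 * w := ⟨y, h'.symm⟩
  exact hw.dvd_mul_right.mp hdvd

/-- **(β) with the floor `r = 2s`: the exact digit, by unit reflection.** Non-free class, floor, one
value `4·unit` at ONE local `φ` ⟹ `s = r/2` is a UNIT of `Λ`. -/
theorem isUnit_of_floor_of_value (φ : Λ →+* O) [IsLocalHom φ]
    (h𝔪 : ∀ x ∈ IsLocalRing.maximalIdeal Λ, (2 : O) ∣ φ x) (h4 : IsLeftRegular (4 : O))
    {B : Ideal Λ} (hB : B ≠ ⊤) {r s x : Λ} (hfloor : r = 2 * s) (hx : x ∈ B) {w : O}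
    (hw : IsUnit w) (hval : φ (r * x) = 4 * w) : IsUnit s := by
  obtain ⟨y, hy⟩ := h𝔪 x (IsLocalRing.le_maximalIdeal hB hx)
  have h : (4 : O) * (φ s * y) = 4 * w := by
    calc (4 : O) * (φ s * y) = (2 * φ s) * (2 * y) := by ring
      _ = φ r * φ x := by rw [hy, hfloor, map_mul, map_ofNat]
      _ = φ (r * x) := by rw [map_mul]
      _ = 4 * w := hval
  have h' : φ s * y = w := h4 h
  have hu : IsUnit (φ s * y) := h'.symm ▸ hw
  exact IsUnit.of_map φ s (isUnit_of_mul_isUnit_left hu)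

omit [IsLocalRing Λ] in
/-- … hence the digit is `v(2)` at EVERY character `ψ` (B49 «pointwise ×6», and more). -/
theorem digit_at_every_character {s : Λ} (hs : IsUnit s) {O' : Type*} [CommRing O']
    (ψ : Λ →+* O') : ∃ u : O'ˣ, ψ (2 * s) = 2 * u :=
  ⟨(hs.map ψ).unit, by rw [map_mul, map_ofNat, IsUnit.unit_spec]⟩

omit [IsLocalRing Λ] in
/-- **(γ) K35, typed: on the FREE class the same value datum gives the OPPOSITE digit.** (`x = 1 ∈ ⊤`;
critic's counter-model `M ≅ Λ_v`, `r_u = 2(γ+1)`: value `4` at `𝟙`, yet `r_u/2 = γ + 1 ∈ 𝔪_v`.) -/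
theorem not_isUnit_of_free_of_value (φ : Λ →+* O) (h2 : IsLeftRegular (2 : O))
    (h2u : ¬ IsUnit (2 : O)) {r s : Λ} (hfloor : r = 2 * s) {w : O}
    (hval : φ (r * 1) = 4 * w) : ¬ IsUnit s := by
  intro hs
  have h : (2 : O) * φ s = 2 * (2 * w) := by
    calc (2 : O) * φ s = φ (r * 1) := by rw [mul_one, hfloor, map_mul, map_ofNat]
      _ = 4 * w := hval
      _ = 2 * (2 * w) := by ring
  have h' : φ s = 2 * w := h2 h
  have hu : IsUnit ((2 : O) * w) := h' ▸ hs.map φ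
  exact h2u (isUnit_of_mul_isUnit_left hu)

end Digit

/-! ## §K  The two shapes of K3 (identification `M_{Γ_n} ≅ Q_n(u)`) the consumers actually need -/
section KThree

/-- **K3_LOWER (weakest, feeds `ne_top_of_torsionCount_ne_one` / §C):** a surjection from a CYCLIC
module has cyclic image — contrapositive: `M ↠ Q_0(u)` (`Γ`-coinvariantly; onto because norms are onto
on `U¹` in the UNRAMIFIED tower `L_∞/L_0`) with `Q_0(u) ≅ ℤ₂ ⊕ ℤ/2` NOT cyclic ⟹ `M_Γ` not cyclic ⟹
`M` not free of rank one ⟹ `𝔟 ≠ ⊤`.  No Hilbert 90, no `lim¹`, no kernel identification. -/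
theorem span_singleton_eq_top_of_surjective {R P Q : Type*} [CommRing R] [AddCommGroup P]
    [Module R P] [AddCommGroup Q] [Module R Q] (f : P →ₗ[R] Q) (hf : Function.Surjective f)
    {g : P} (hg : Submodule.span R {g} = ⊤) : Submodule.span R {f g} = ⊤ := by
  rw [← Set.image_singleton, ← Submodule.map_span, hg, Submodule.map_top, LinearMap.range_eq_top]
  exact hf

/-- **K3_EXACT (feeds `eq_maximalIdeal_of_torsionCount` / `eq_top_of_torsionCount`), one layer:**
norm ONTO (unramified) and `ker N = (γ - 1)A` (Hilbert 90 with UNITS in an unramified cyclic layer)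
give `A/(γ-1)A ≃ B`; the limit over `n` is compactness (Mittag-Leffler for profinite groups). -/
noncomputable def coinvariantsEquivOfNorm {A B : Type*} [AddCommGroup A] [AddCommGroup B]
    (γ : A →+ A) (N : A →+ B) (hN : Function.Surjective N)
    (hker : N.ker = (γ - AddMonoidHom.id A).range) :
    A ⧸ (γ - AddMonoidHom.id A).range ≃+ B :=
  (QuotientAddGroup.quotientAddEquivOfEq hker.symm).trans
    (QuotientAddGroup.quotientKerEquivOfSurjective N hN)

end KThree

/-! ## Toy checks (the critic's two models, `γ = 1 + X`, `𝟙 : X ↦ 0`, `ρ(γ) = -1 : X ↦ -2`) -/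
section Toy

open Polynomial

/-- K35 counter-model `M ≅ Λ_v`, `r = 2(γ+1) = 2(X+2)`: value `4` at `𝟙` but `0` at `ρ`. -/
example : (2 * (X + 2) : ℤ[X]).eval 0 = 4 ∧ (2 * (X + 2) : ℤ[X]).eval (-2) = 0 := by
  constructor <;> norm_num

/-- versus `r = 2γ = 2(X+1)` (`r/2` a unit of `ℤ₂⟦X⟧`): a `2·unit` value at both characters. -/
example : (2 * (X + 1) : ℤ[X]).eval 0 = 2 ∧ (2 * (X + 1) : ℤ[X]).eval (-2) = -2 := by
  constructor <;> norm_num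

/-- the augmentation `𝟙 : Λ = R⟦X⟧ → R` (trivial character) is a local hom — unit reflection, §C (β);
so is `ev_ρ : f ↦ f(ρ(γ) - 1)` for `ρ(γ) - 1 ∈ 2ℤ₂` (typer: compose with the substitution `X ↦ X + c`). -/
theorem isLocalHom_constantCoeff (R : Type*) [CommRing R] :
    IsLocalHom (PowerSeries.constantCoeff (R := R)) :=
  ⟨fun _ h => PowerSeries.isUnit_iff_constantCoeff.2 h⟩

end Toy

end Summit.BirchSwinnertonDyer.BirchSwinnertonDyer.Cruxes.SplitBadTwoLowerHalfOfFacts.TorsionCensusK1G29
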